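import Literature.Geometry.Kaehler.ComplexTorusHodgeGeneralEndomorphisms
import Literature.Geometry.Kaehler.ComplexTorusLefschetzLieAlgebraRatReductive
import Literature.Geometry.Kaehler.ComplexTorusLefschetzLieAlgebraRatFunctoriality
import HarnessLib

/-!
# The generic row of Milne's table, conversely: `S(X) = Sp(V, e)` — as `Lf(X)(ℝ) = Sp(V_ℝ, E)`, as `Lie S(X) = 𝔰𝔭_ℚ(G)`,
# as `𝔩𝔣 = 𝔰𝔭(V_ℝ, E)`, or as `dim_ℚ Lie S(X) = g(2g+1)` — IFF `End_ℚ(X) = ℚ`, for a polarised complex torus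

Layer `Literature/Geometry/Kaehler`, namespace `Literature.Geometry.Kaehler.ComplexTorus`; lane `lit-hodgefound` (Track 2
foundations library); prover seat `lit-hodgefound-p17`, generation 60, self-proposed row g60-#8 — the CONVERSES of the tree's
`lefschetzGroup_eq_spGroup_of_endAlgRat_eq_bot` (`End_ℚ(X) = ℚ ⟹ Lf(X)(ℝ) = Sp(V_ℝ, E)`),
`lefschetzLieRat_eq_skewAdjointMatricesLieSubalgebra_of_endAlgRat_eq_bot` (`End_ℚ(X) = ℚ ⟹ Lie S(X) = 𝔰𝔭`) and
`IsRiemannForm.finrank_lefschetzLieRat_eq_iff_eq_skewAdjoint` (`dim = g(2g+1) ⟺ Lie S = 𝔰𝔭`): if `S(X)` is all of `Sp(e)` — at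
the level of real points, of the rational Lie algebra, of the real Lie algebra, or of the dimension — then every endomorphism
commutes with `𝔰𝔭(V_ℝ, E)` (Milne: the elements of `S(A)` «commute with the endomorphisms of `A`»; `𝔰𝔭` is defined over `ℚ`,
§1; `𝔰𝔭(V_ℝ, E) = Lie Sp(V_ℝ, E)`, the tree's exponential characterisations), hence is a real scalar by the tree's Schur lemma
`IsRiemannForm.exists_eq_smul_one_of_forall_skewAdjoint_latticeGram_comm` (the commutant of `𝔰𝔭(V, E)` is `ℝ`), hence a
rational scalar.  The Lefschetz analogue of the tree's `IsRiemannForm.endAlgRat_eq_bot_of_hodgeGroup_eq_spGroup`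
(`Hg = Sp ⟹ End_ℚ = ℚ`, Lange Prop. 7.3.2/7.3.3); NOTE `S(X) = Sp` does not give `Hg(X) = Sp` (Mumford's fourfolds have
`End_ℚ = ℚ`, `S = Sp₈`, `Hg ≠ Sp₈`), only `End_ℚ(X) = ℚ`.  THEOREMS ONLY (no definition, no instance, no notation, no named
fact; D-0026 net debt `0`).

## Sources, VERBATIM

* J. S. Milne [Milne1999LefschetzClasses], Duke Math. J. **96** (1999), §1 p. 644 («Thus, for any ample divisor `D` on `A`,
  `S(A)` is the largest algebraic subgroup of `Sp(e_D)` whose elements commute with the endomorphisms of `A`»), Remark 1.2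
  («the centralizer of `C(A)` in `End_k(V(A))` is `End⁰(A) ⊗_ℚ k`») and §2 Summary table p. 652 (row I: group `Sp_{2g}` when
  `F = ℚ`, dimension `2g²/f + g`).
* H. Lange [Lange2023AbelianVarietiesComplex], §7.2.4 Exercise (3) («`End_ℚ(X) = End_{Hg(X)}(H_1(X,ℚ))`»), Exercise (4)
  («`Lf(X) := {g ∈ Sp(W, E) | g ∘ φ = φ ∘ g for all φ ∈ End_ℚ(X)}⁰`», (b) «`Lf(X)` is an algebraic group defined over `ℚ`
  containing `Hg(X)`»), §7.3.1 Prop. 7.3.2, proof of Prop. 7.3.3 («the standard representation of `Sp(V, E)(ℂ) ≃ Sp_{2g}(ℂ)`»)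
  and §7.3.2 Lemma 7.3.7.
* W. Fulton, J. Harris [FultonHarris1991], §17.2 Thm. 17.5 (the standard representation of `𝔰𝔭_{2n}` is irreducible).

## What is proved (`X = E/Φ(ℤ^ι)` with Riemann form `η`, rational Gram matrix `G`, `G ⊗ 1 = latticeGram Φ η`, `g = dim X`)

* §1 `𝔰𝔭` IS DEFINED OVER `ℚ`: **`span_ratCast_image_skewAdjointMatricesSubmodule_eq`** (`span_ℝ (𝔰𝔭_ℚ(G) ⊗ 1) = 𝔰𝔭_ℝ(G ⊗ 1)`
  for `G` alternating non-degenerate, by the dimension count `C(n+1, 2)` on both sides) and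
  `forall_skewAdjoint_map_ratCast_comm_of_forall_skewAdjoint_comm`.
* §2 THE CONVERSES: **`IsRiemannForm.endAlgRat_eq_bot_of_lefschetzGroup_eq_spGroup`** (`Lf(X)(ℝ) = Sp(V_ℝ, E) ⟹ End_ℚ(X) = ℚ`)
  and **`IsRiemannForm.lefschetzGroup_eq_spGroup_iff_endAlgRat_eq_bot`**;
  **`IsRiemannForm.endAlgRat_eq_bot_of_lefschetzLieRat_eq_skewAdjoint`** (`Lie S(X) = 𝔰𝔭_ℚ(G) ⟹ End_ℚ(X) = ℚ`) and
  **`IsRiemannForm.lefschetzLieRat_eq_skewAdjoint_iff_endAlgRat_eq_bot`**; the real Lie algebra form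
  `IsRiemannForm.lefschetzLie_eq_skewAdjoint_iff_endAlgRat_eq_bot` (`𝔩𝔣 = 𝔰𝔭(V_ℝ, E) ⟺ End_ℚ(X) = ℚ`); the dimension forms
  **`IsRiemannForm.finrank_lefschetzLieRat_eq_iff_endAlgRat_eq_bot`** (`dim_ℚ Lie S(X) = g(2g+1) ⟺ End_ℚ(X) = ℚ`),
  `…finrank_lefschetzLie_eq_iff_endAlgRat_eq_bot`, `IsRiemannForm.finrank_lefschetzLieRat_lt_iff_endAlgRat_ne_bot`; and the
  four descriptions of the generic row are equivalent to each other (`IsRiemannForm.lefschetzGroup_eq_spGroup_iff_lefschetzLieRat_eq_skewAdjoint`);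
  finally `IsRiemannForm.isSimple_of_lefschetzGroup_eq_spGroup` / `…_of_lefschetzLieRat_eq_skewAdjoint` (then `X` is simple: row I(1)).
-/

noncomputable section

open scoped Matrix
open Module Matrix Complex Function

namespace Literature.Geometry.Kaehler

namespace ComplexTorus

/-! ## §1 `𝔰𝔭` is defined over `ℚ` -/

section DefinedOverQ

variable {ι : Type*} [Fintype ι] [DecidableEq ι]

/-- The realification of a rational `G`-skew matrix is `(G ⊗ 1)`-skew (`ᵗ(A ⊗ 1) = ᵗA ⊗ 1`). [folklore] -/
private theorem map_ratCast_mem_skewAdjoint {G A : Matrix ι ι ℚ} (hA : A ∈ skewAdjointMatricesSubmodule G) :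
    A.map ((↑) : ℚ → ℝ) ∈ skewAdjointMatricesSubmodule (G.map ((↑) : ℚ → ℝ)) := by
  rw [mem_skewAdjointMatricesSubmodule_iff_transpose_mul_add_mul_eq_zero] at hA ⊢
  have h := congrArg (Rat.castHom ℝ).mapMatrix hA
  rw [map_add, map_mul, map_mul, map_zero] at h
  simpa only [RingHom.mapMatrix_apply, Rat.coe_castHom, Matrix.transpose_map] using h

/-- **`𝔰𝔭` IS DEFINED OVER `ℚ`: `span_ℝ (𝔰𝔭_ℚ(G) ⊗ 1) = 𝔰𝔭_ℝ(G ⊗ 1)`** for an alternating non-degenerate rational `G` (both sides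
have dimension `C(#ι + 1, 2)`: the tree's `finrank_span_ratCast_image_eq` «`dim_ℝ (W ⊗ ℝ) = dim_ℚ W`» and the field-generic count
`finrank_skewAdjointMatricesSubmodule_of_transpose_eq_neg`). [cite: Lange2023AbelianVarietiesComplex, §7.2.4 Exercise (4)(b) («`Lf(X)` is an algebraic group defined over `ℚ`»)]
[cite: Springer1998, §11.1.1 (subspaces defined over a subfield)] [cite: BolsinovFomenko2004, Ch. 1 §1.1 Prop. 1.3 (a)] -/
theorem span_ratCast_image_skewAdjointMatricesSubmodule_eq {G : Matrix ι ι ℚ} (hGt : Gᵀ = -G) (hGu : IsUnit G.det) :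
    Submodule.span ℝ ((fun A : Matrix ι ι ℚ ↦ A.map ((↑) : ℚ → ℝ)) '' (skewAdjointMatricesSubmodule G : Set (Matrix ι ι ℚ))) =
      skewAdjointMatricesSubmodule (G.map ((↑) : ℚ → ℝ)) := by
  classical
  apply Submodule.eq_of_le_of_finrank_eq
  · rw [Submodule.span_le]
    rintro _ ⟨A, hA, rfl⟩
    exact map_ratCast_mem_skewAdjoint hA
  · have hGt' : (G.map ((↑) : ℚ → ℝ))ᵀ = -G.map ((↑) : ℚ → ℝ) := by
      rw [← Matrix.transpose_map, hGt, Matrix.map_neg _ Rat.cast_neg]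
    have hGu' : IsUnit (G.map ((↑) : ℚ → ℝ)).det := by
      rw [show G.map ((↑) : ℚ → ℝ) = (Rat.castHom ℝ).mapMatrix G from rfl, ← RingHom.map_det]
      exact hGu.map _
    rw [finrank_span_ratCast_image_eq, finrank_skewAdjointMatricesSubmodule_of_transpose_eq_neg hGt hGu,
      finrank_skewAdjointMatricesSubmodule_of_transpose_eq_neg hGt' hGu']

/-- A real matrix commuting with the realifications of `𝔰𝔭_ℚ(G)` commutes with all of `𝔰𝔭_ℝ(G ⊗ 1)` (`G` alternating,
non-degenerate). [cite: Lange2023AbelianVarietiesComplex, §7.2.4 Exercise (4)(b) and §7.3.1, proof of Prop. 7.3.3] [cite: Springer1998, §11.1.1] -/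
theorem forall_skewAdjoint_map_ratCast_comm_of_forall_skewAdjoint_comm {G : Matrix ι ι ℚ} (hGt : Gᵀ = -G)
    (hGu : IsUnit G.det) {Y : Matrix ι ι ℝ}
    (hY : ∀ A ∈ skewAdjointMatricesSubmodule G, A.map ((↑) : ℚ → ℝ) * Y = Y * A.map ((↑) : ℚ → ℝ)) :
    ∀ X ∈ skewAdjointMatricesSubmodule (G.map ((↑) : ℚ → ℝ)), X * Y = Y * X := by
  intro X hX
  rw [← span_ratCast_image_skewAdjointMatricesSubmodule_eq hGt hGu] at hX
  induction hX using Submodule.span_induction with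
  | mem Z hZ =>
    obtain ⟨A, hA, rfl⟩ := hZ
    exact hY A hA
  | zero => rw [Matrix.zero_mul, Matrix.mul_zero]
  | add Z W _ _ hZ hW => rw [Matrix.add_mul, Matrix.mul_add, hZ, hW]
  | smul c Z _ hZ => rw [Matrix.smul_mul, Matrix.mul_smul, hZ]

end DefinedOverQ

/-! ## §2 `S(X) = Sp(V, e) ⟺ End_ℚ(X) = ℚ` -/

section GenericRow

variable {ι : Type*} [Fintype ι] [DecidableEq ι] {E : Type*} [NormedAddCommGroup E] [NormedSpace ℂ E]
  [FiniteDimensional ℂ E] {Φ : (ι → ℝ) ≃L[ℝ] E} {η : E [⋀^Fin 2]→L[ℝ] ℝ} {G : Matrix ι ι ℚ}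

/-- A rational matrix whose realification commutes with `𝔰𝔭(V_ℝ, E)` is a rational scalar: a real scalar by Schur (tree),
and `M ⊗ 1 = c·1` forces `c = M_{ii} ∈ ℚ`. [cite: Lange2023AbelianVarietiesComplex, §7.3.1, proof of Prop. 7.3.3 and §7.3.2 Lemma 7.3.7]
[cite: FultonHarris1991, §17.2 Thm. 17.5] -/
private theorem IsRiemannForm.mem_bot_of_forall_skewAdjoint_latticeGram_comm (hη : IsRiemannForm Φ η)
    {M : Matrix ι ι ℚ}
    (hcomm : ∀ X ∈ skewAdjointMatricesSubmodule (latticeGram Φ η),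
      X * M.map ((↑) : ℚ → ℝ) = M.map ((↑) : ℚ → ℝ) * X) :
    M ∈ (⊥ : Subalgebra ℚ (Matrix ι ι ℚ)) := by
  obtain ⟨c, hc⟩ := hη.exists_eq_smul_one_of_forall_skewAdjoint_latticeGram_comm hcomm
  rcases isEmpty_or_nonempty ι with hι | ⟨⟨i⟩⟩
  · rw [Subsingleton.elim M 0]
    exact (⊥ : Subalgebra ℚ (Matrix ι ι ℚ)).zero_mem
  · have hc' : ∀ j k, ((M j k : ℚ) : ℝ) = c * (1 : Matrix ι ι ℝ) j k := fun j k ↦ by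
      have h' := congr_fun (congr_fun hc j) k
      rwa [Matrix.map_apply, Matrix.smul_apply, smul_eq_mul] at h'
    have hci : ((M i i : ℚ) : ℝ) = c := by rw [hc' i i, Matrix.one_apply_eq, mul_one]
    have hq : M = algebraMap ℚ (Matrix ι ι ℚ) (M i i) := by
      ext j k
      apply Rat.cast_injective (α := ℝ)
      rw [hc' j k, ← hci, Matrix.algebraMap_matrix_apply, Algebra.algebraMap_self_apply]
      split_ifs with hjk
      · rw [hjk, Matrix.one_apply_eq, mul_one]
      · rw [Matrix.one_apply_ne hjk, mul_zero, Rat.cast_zero]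
    rw [hq]
    exact Subalgebra.algebraMap_mem _ _

/-- **`Lf(X)(ℝ) = Sp(V_ℝ, E) ⟹ End_ℚ(X) = ℚ`** (real points of Milne's `S(X)`): every `X ∈ 𝔰𝔭(V_ℝ, E)` exponentiates into
`Sp(V_ℝ, E) = Lf(X)(ℝ)`, so lies in `𝔩𝔣` and commutes with `End_ℚ(X) ⊗ 1`; then Schur.
[cite: Milne1999LefschetzClasses, §1 p. 644 («`S(A)` is the largest algebraic subgroup of `Sp(e_D)` whose elements commute with the endomorphisms of `A`») and Remark 1.2]
[cite: Lange2023AbelianVarietiesComplex, §7.2.4 Exercise (4), §7.3.1 Prop. 7.3.2 and proof of Prop. 7.3.3] [cite: FultonHarris1991, §17.2 Thm. 17.5] -/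
theorem IsRiemannForm.endAlgRat_eq_bot_of_lefschetzGroup_eq_spGroup (hη : IsRiemannForm Φ η)
    (h : lefschetzGroup Φ η = spGroup Φ η) : endAlgRat Φ = ⊥ := by
  obtain ⟨G, hG⟩ := hη.exists_ratMatrix_latticeGram
  refine eq_bot_iff.2 fun M hM ↦ hη.mem_bot_of_forall_skewAdjoint_latticeGram_comm fun X hX ↦ ?_
  have hX' : X ∈ lefschetzLie Φ G := by
    rw [hη.mem_lefschetzLie_iff_forall_exp_mem_lefschetzGroup hG, h]
    exact hη.mem_skewAdjointMatricesSubmodule_latticeGram_iff_forall_exists_mem_spGroup.1 hX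
  exact ((mem_lefschetzLie_iff (Φ := Φ)).1 hX').2 M hM

/-- **THE GENERIC ROW AT THE LEVEL OF REAL POINTS: `Lf(X)(ℝ) = Sp(V_ℝ, E) ⟺ End_ℚ(X) = ℚ`.**
[cite: Milne1999LefschetzClasses, §1 p. 644 and §2 Summary table p. 652 (row I, `F = ℚ`: `Sp_{2g}`)] [cite: Lange2023AbelianVarietiesComplex, §7.2.4 Exercise (4) and §7.3.1 Prop. 7.3.2] -/
theorem IsRiemannForm.lefschetzGroup_eq_spGroup_iff_endAlgRat_eq_bot (hη : IsRiemannForm Φ η) :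
    lefschetzGroup Φ η = spGroup Φ η ↔ endAlgRat Φ = ⊥ :=
  ⟨hη.endAlgRat_eq_bot_of_lefschetzGroup_eq_spGroup, fun hE ↦ lefschetzGroup_eq_spGroup_of_endAlgRat_eq_bot Φ hE η⟩

/-- `Lf(X)(ℝ) = Sp(V_ℝ, E) ⟹ Lf(X)(ℝ) = Sp(V_ℝ, E')` for EVERY real `2`-form `E'` (through `End_ℚ(X) = ℚ`).
[cite: Lange2023AbelianVarietiesComplex, §7.2.4 Exercise (4)(a) («`Lf(X)` does not depend on the polarization»)] -/
theorem IsRiemannForm.lefschetzGroup_eq_spGroup_of_lefschetzGroup_eq_spGroup (hη : IsRiemannForm Φ η)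
    (h : lefschetzGroup Φ η = spGroup Φ η) (η' : E [⋀^Fin 2]→L[ℝ] ℝ) : lefschetzGroup Φ η' = spGroup Φ η' :=
  lefschetzGroup_eq_spGroup_of_endAlgRat_eq_bot Φ (hη.endAlgRat_eq_bot_of_lefschetzGroup_eq_spGroup h) η'

/-- **`Lie S(X) = 𝔰𝔭_ℚ(G) ⟹ End_ℚ(X) = ℚ`**: every endomorphism `M` commutes with `Lie S(X)` (tree: `Lie S(X) ⊆ C(X)`), here
with all of `𝔰𝔭_ℚ(G)`, hence (§1) `M ⊗ 1` commutes with `𝔰𝔭(V_ℝ, E)`; then Schur. [cite: Milne1999LefschetzClasses, §1 p. 644 and Remark 1.2]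
[cite: Lange2023AbelianVarietiesComplex, §7.2.4 Exercise (4)(b), §7.3.1 Prop. 7.3.2 and proof of Prop. 7.3.3] [cite: FultonHarris1991, §17.2 Thm. 17.5] -/
theorem IsRiemannForm.endAlgRat_eq_bot_of_lefschetzLieRat_eq_skewAdjoint (hη : IsRiemannForm Φ η)
    (hG : G.map (Rat.cast : ℚ → ℝ) = latticeGram Φ η) (h : lefschetzLieRat Φ G = skewAdjointMatricesLieSubalgebra G) :
    endAlgRat Φ = ⊥ := by
  have hGu : IsUnit G.det := isUnit_det_of_map_ratCast hG hη.isUnit_det_latticeGram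
  have hGt : Gᵀ = -G := transpose_eq_neg_of_map_ratCast Φ hG
  refine eq_bot_iff.2 fun M hM ↦ hη.mem_bot_of_forall_skewAdjoint_latticeGram_comm fun X hX ↦ ?_
  -- `M` commutes with `𝔰𝔭_ℚ(G) = Lie S(X)`, realified
  have hcommQ : ∀ A ∈ skewAdjointMatricesSubmodule G,
      A.map ((↑) : ℚ → ℝ) * M.map ((↑) : ℚ → ℝ) = M.map ((↑) : ℚ → ℝ) * A.map ((↑) : ℚ → ℝ) := by
    intro A hA
    have hA' : A ∈ lefschetzLieRat Φ G := by
      rw [h]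
      exact hA
    have hc := congrArg (Rat.castHom ℝ).mapMatrix (mul_comm_of_mem_lefschetzLieRat hA' hM)
    rw [map_mul, map_mul] at hc
    simpa only [RingHom.mapMatrix_apply, Rat.coe_castHom] using hc
  rw [← hG] at hX
  exact forall_skewAdjoint_map_ratCast_comm_of_forall_skewAdjoint_comm hGt hGu hcommQ X hX

/-- **THE GENERIC ROW AT THE LEVEL OF THE RATIONAL LIE ALGEBRA: `Lie S(X) = 𝔰𝔭_ℚ(G) ⟺ End_ℚ(X) = ℚ`.**
[cite: Milne1999LefschetzClasses, §1 p. 644 and §2 Summary table p. 652 (row I, `F = ℚ`: `Sp_{2g}`)] [cite: Lange2023AbelianVarietiesComplex, §7.2.4 Exercise (4) and §7.3.1 Prop. 7.3.2] -/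
theorem IsRiemannForm.lefschetzLieRat_eq_skewAdjoint_iff_endAlgRat_eq_bot (hη : IsRiemannForm Φ η)
    (hG : G.map (Rat.cast : ℚ → ℝ) = latticeGram Φ η) :
    lefschetzLieRat Φ G = skewAdjointMatricesLieSubalgebra G ↔ endAlgRat Φ = ⊥ :=
  ⟨hη.endAlgRat_eq_bot_of_lefschetzLieRat_eq_skewAdjoint hG,
    lefschetzLieRat_eq_skewAdjointMatricesLieSubalgebra_of_endAlgRat_eq_bot G⟩

/-- **The four descriptions of the generic row agree: `Lf(X)(ℝ) = Sp(V_ℝ, E) ⟺ Lie S(X) = 𝔰𝔭_ℚ(G)`** (both iff `End_ℚ(X) = ℚ`).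
[cite: Milne1999LefschetzClasses, §1 p. 644 and §2 Summary table p. 652 (row I)] [cite: Lange2023AbelianVarietiesComplex, §7.2.4 Exercise (4)] -/
theorem IsRiemannForm.lefschetzGroup_eq_spGroup_iff_lefschetzLieRat_eq_skewAdjoint (hη : IsRiemannForm Φ η)
    (hG : G.map (Rat.cast : ℚ → ℝ) = latticeGram Φ η) :
    lefschetzGroup Φ η = spGroup Φ η ↔ lefschetzLieRat Φ G = skewAdjointMatricesLieSubalgebra G := by
  rw [hη.lefschetzGroup_eq_spGroup_iff_endAlgRat_eq_bot, hη.lefschetzLieRat_eq_skewAdjoint_iff_endAlgRat_eq_bot hG]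

/-- **THE GENERIC ROW AT THE LEVEL OF THE REAL LIE ALGEBRA: `𝔩𝔣 = 𝔰𝔭(V_ℝ, E) ⟺ End_ℚ(X) = ℚ`** (`𝔩𝔣 = span_ℝ (Lie S(X) ⊗ 1)`,
the tree's `toSubmodule_lefschetzLie_eq_span_rat`, and §1). [cite: Lange2023AbelianVarietiesComplex, §7.3.1 Prop. 7.3.2, proof of Prop. 7.3.3 and §7.2.4 Exercise (4)(b)]
[cite: Milne1999LefschetzClasses, §1 p. 644] -/
theorem IsRiemannForm.lefschetzLie_eq_skewAdjoint_iff_endAlgRat_eq_bot (hη : IsRiemannForm Φ η)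
    (hG : G.map (Rat.cast : ℚ → ℝ) = latticeGram Φ η) :
    lefschetzLie Φ G = skewAdjointMatricesLieSubalgebra (latticeGram Φ η) ↔ endAlgRat Φ = ⊥ := by
  refine ⟨fun h ↦ eq_bot_iff.2 fun M hM ↦ hη.mem_bot_of_forall_skewAdjoint_latticeGram_comm fun X hX ↦ ?_, fun hE ↦ ?_⟩
  · have hX' : X ∈ lefschetzLie Φ G := by
      rw [h]
      exact hX
    exact ((mem_lefschetzLie_iff (Φ := Φ)).1 hX').2 M hM
  · -- as subsets of `M_ι(ℝ)`: `𝔩𝔣 = span_ℝ (Lie S(X) ⊗ 1) = span_ℝ (𝔰𝔭_ℚ(G) ⊗ 1) = 𝔰𝔭_ℝ(G ⊗ 1) = 𝔰𝔭(V_ℝ, E)`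
    have hcoeQ : (skewAdjointMatricesLieSubalgebra G : Set (Matrix ι ι ℚ)) = skewAdjointMatricesSubmodule G := rfl
    have hcoeR : (skewAdjointMatricesLieSubalgebra (latticeGram Φ η) : Set (Matrix ι ι ℝ)) =
        skewAdjointMatricesSubmodule (latticeGram Φ η) := rfl
    refine SetLike.ext' ?_
    rw [hcoeR, coe_lefschetzLie_eq_span_rat Φ G, lefschetzLieRat_eq_skewAdjointMatricesLieSubalgebra_of_endAlgRat_eq_bot G hE,
      hcoeQ, span_ratCast_image_skewAdjointMatricesSubmodule_eq (transpose_eq_neg_of_map_ratCast Φ hG)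
        (isUnit_det_of_map_ratCast hG hη.isUnit_det_latticeGram), hG]

/-- **THE GENERIC ROW BY DIMENSION: `dim_ℚ Lie S(X) = g(2g+1) ⟺ End_ℚ(X) = ℚ`** — the dimension `2g² + g` of row I with `f = 1`
occurs exactly for `End_ℚ(X) = ℚ`. [cite: Milne1999LefschetzClasses, §2 Summary table p. 652 (row I: dimension `2g²/f + g`)]
[cite: Lange2023AbelianVarietiesComplex, §7.3.1 Prop. 7.3.2] [cite: BolsinovFomenko2004, Ch. 1 §1.1 Prop. 1.3 (a)] -/
theorem IsRiemannForm.finrank_lefschetzLieRat_eq_iff_endAlgRat_eq_bot (hη : IsRiemannForm Φ η)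
    (hG : G.map (Rat.cast : ℚ → ℝ) = latticeGram Φ η) :
    finrank ℚ (lefschetzLieRat Φ G) = finrank ℂ E * (2 * finrank ℂ E + 1) ↔ endAlgRat Φ = ⊥ := by
  rw [hη.finrank_lefschetzLieRat_eq_iff_eq_skewAdjoint hG, hη.lefschetzLieRat_eq_skewAdjoint_iff_endAlgRat_eq_bot hG]

/-- `dim_ℚ Lie S(X) < g(2g+1) ⟺ End_ℚ(X) ≠ ℚ`: a non-scalar endomorphism cuts `S(X)` down, and only that does.
[cite: Milne1999LefschetzClasses, §1 p. 644 and §2 Summary table p. 652] [cite: Lange2023AbelianVarietiesComplex, §7.2.4 Exercise (4)(b)] -/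
theorem IsRiemannForm.finrank_lefschetzLieRat_lt_iff_endAlgRat_ne_bot (hη : IsRiemannForm Φ η)
    (hG : G.map (Rat.cast : ℚ → ℝ) = latticeGram Φ η) :
    finrank ℚ (lefschetzLieRat Φ G) < finrank ℂ E * (2 * finrank ℂ E + 1) ↔ endAlgRat Φ ≠ ⊥ := by
  rw [Ne, ← hη.finrank_lefschetzLieRat_eq_iff_endAlgRat_eq_bot hG]
  exact ⟨fun h ↦ h.ne, fun h ↦ lt_of_le_of_ne (hη.finrank_lefschetzLieRat_le hG) h⟩

/-- The real form: `dim_ℝ 𝔩𝔣 = g(2g+1) ⟺ End_ℚ(X) = ℚ`. [cite: Lange2023AbelianVarietiesComplex, §7.3.1 Prop. 7.3.2 and §7.2.4 Exercise (4)]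
[cite: BolsinovFomenko2004, Ch. 1 §1.1 Prop. 1.3 (a)] -/
theorem IsRiemannForm.finrank_lefschetzLie_eq_iff_endAlgRat_eq_bot (hη : IsRiemannForm Φ η)
    (hG : G.map (Rat.cast : ℚ → ℝ) = latticeGram Φ η) :
    finrank ℝ (lefschetzLie Φ G) = finrank ℂ E * (2 * finrank ℂ E + 1) ↔ endAlgRat Φ = ⊥ := by
  rw [← finrank_lefschetzLieRat_eq_finrank_lefschetzLie, hη.finrank_lefschetzLieRat_eq_iff_endAlgRat_eq_bot hG]

/-- **`Lf(X)(ℝ) = Sp(V_ℝ, E) ⟹ X` is simple** (with `End_ℚ(X) = ℚ`: row I(1) of the table).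
[cite: Milne1999LefschetzClasses, §2 Summary table p. 652 (row I, `F = ℚ`)] [cite: Lange2023AbelianVarietiesComplex, §7.3.1 Prop. 7.3.2] -/
theorem IsRiemannForm.isSimple_of_lefschetzGroup_eq_spGroup (hη : IsRiemannForm Φ η)
    (h : lefschetzGroup Φ η = spGroup Φ η) : IsSimple Φ :=
  hη.isSimple_of_endAlgRat_eq_bot (hη.endAlgRat_eq_bot_of_lefschetzGroup_eq_spGroup h)

/-- **`Lie S(X) = 𝔰𝔭_ℚ(G) ⟹ X` is simple.** [cite: Milne1999LefschetzClasses, §2 Summary table p. 652 (row I, `F = ℚ`)]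
[cite: Lange2023AbelianVarietiesComplex, §7.3.1 Prop. 7.3.2] -/
theorem IsRiemannForm.isSimple_of_lefschetzLieRat_eq_skewAdjoint (hη : IsRiemannForm Φ η)
    (hG : G.map (Rat.cast : ℚ → ℝ) = latticeGram Φ η) (h : lefschetzLieRat Φ G = skewAdjointMatricesLieSubalgebra G) :
    IsSimple Φ :=
  hη.isSimple_of_endAlgRat_eq_bot (hη.endAlgRat_eq_bot_of_lefschetzLieRat_eq_skewAdjoint hG h)

/-- `dim_ℚ Lie S(X) = g(2g+1) ⟹ X` is simple. [cite: Milne1999LefschetzClasses, §2 Summary table p. 652 (row I, `F = ℚ`)]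
[cite: Lange2023AbelianVarietiesComplex, §7.3.1 Prop. 7.3.2] -/
theorem IsRiemannForm.isSimple_of_finrank_lefschetzLieRat_eq (hη : IsRiemannForm Φ η)
    (hG : G.map (Rat.cast : ℚ → ℝ) = latticeGram Φ η)
    (h : finrank ℚ (lefschetzLieRat Φ G) = finrank ℂ E * (2 * finrank ℂ E + 1)) : IsSimple Φ :=
  hη.isSimple_of_endAlgRat_eq_bot ((hη.finrank_lefschetzLieRat_eq_iff_endAlgRat_eq_bot hG).1 h)

end GenericRow

end ComplexTorus

end Literature.Geometry.Kaehler

end
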